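import Summits.QuantumFields.BalabanUV.Beta.GAN24.DirichletVertexLocalT

/-!
# `BalabanUV.Beta.GAN24.DirichletVertexLocate` — binder row G-an2-4 / (CONV-C), road P2 PART IV, leaf L14 (the torus transfer), FILE C5b-1:
# LOCATING A TORUS SITE IN THE WINDOW CENSUS — every site is an identity-oriented chart site of its own block, vertex shift and
# re-orientation of the chart, rounding of in-block offsets to the grid `q·{0,…,4}`, and the product / re-entrant / isolated trichotomy of
# a block inside a vertex star (unit b2b-balaban-gan24-p2, gen 27, v1)

HONEST FRAMING (cell contract, verbatim): «discharging `BetaPertH` makes Bałaban's UV stability UNCONDITIONAL — a real constructive-QFT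
result; it is NOT the continuum limit and NOT the Clay problem.»  SUPPLIER module under the T⁴-DAG sub-row `T4-U1a.S-NE2-D1-DIRICHLET°`
(owner wording R24 «the full rate L⁻¹ beyond boxes OPEN»).  Binder (A′) of the weighted socket `DirichletBoxWeightedSockets.injected_le_of_weighted`
(p234489) is assembled from per-window Hessian bounds (`DirichletVertexHessian` near re-entrant vertices, translated product windows,
`DirichletVertexPiece` on isolated quadrant pieces) by a POINTWISE DOMINATION of the weight
on `Ω` by the sum of the window weights (next file, `DirichletVertexDom`).  That needs, for an arbitrary torus site `x`, chart coordinates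
in a window whose plateau contains `x`; this file supplies the bookkeeping.

## Contents ([folklore] `ZMod`/`Bool` bookkeeping on the tree's typed torus; 0 sorry)
* §1 the identity orientation `TT`; `emb TT b i j = up b + (i, j)`; **`emb_TT_blockOf`**: `x = emb TT (blockOf x) o₀ o₁` with
  `o_ν = (x ν).val % n`; the vertex shift `emb TT (b + e_μ) i j = emb TT b (i + n·δ_{μ0}) (j + n·δ_{μ1})`; the re-orientation
  `emb σ b (crd σ 0 i) (crd σ 1 j) = emb TT b i j`, `tIdx (crd σ ν c) = tIdx c`, `0 ≤ crd σ ν c ↔ decide (0 ≤ c) = σ ν`.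
* §2 star patterns in the identity orientation: `starBlk σ b p = starBlk TT b (p ≡ σ)`, **`reentrantAt_iff_TT`** (re-entrant at `σ` ⟺
  the identity-oriented star misses exactly the pattern `σ`); the product data `Arow`, `Bcol`, `IsProdAt` (decidable); the trichotomy
  **`exists_reentrant`**: a block of `S` in the star of `b` that is neither in a product star nor an isolated piece sits at a re-entrant vertex.
* §3 rounding to the grid: `rnd q o = ⌊o/q + 1/2⌋`, `|o − q·rnd| ≤ q/2`, `rnd ≤ 4` on a block (`q = ⌊n/4⌋ ≥ 5`).

ABSOLUTE RULE (cell, verbatim): «No internally-minted statement may enter as a cited fact. Every hypothesis is either kernel-proved in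
this package or a verbatim quotation of a PUBLISHED theorem with page reference. The manuscript(s) under audit are NOT citable for
their own disputed steps — they are the thing under adjudication; programme-internal (2001/route/tribunal) claims are never citable.»
Nothing printed is a hypothesis; no estimate of any Bałaban object is made here.  NOT CLAIMED: the domination lemma, (A′), (Φ)/(Φ′), the
END (p234489 stays CONDITIONAL); NOT the vector layer, NE2, (CONV-C) as a whole, `BetaPertH`, continuum, Clay.  «not in print; our proof
attempt».  HONEST DEPENDENCY: continuum YM on T⁴ ⇐ BetaPertH ∧ nine spine estimates (0/9 proved); BetaPertH ⇐ (D1) ∧ (D4) ∧ CAP+tail;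
G-an2-4 gates asym, D1 and NE2/3/4.
-/

noncomputable section

open scoped BigOperators
open Finset

namespace Summit.QuantumFields.BalabanUV.Beta.GAN24.DirichletVertexLocate

open Literature.MathematicalPhysics.QuantumFieldTheory.Balaban1983to89.B5Prop11Plancherel (Tor fine unitVec)
open Literature.MathematicalPhysics.QuantumFieldTheory.Balaban1983to89.B5Block118 (bpt up tstep upHom upHom_intCast up_add up_unitVec)
open Literature.MathematicalPhysics.QuantumFieldTheory.Balaban1983to89.B5Blocks16 (blockOf blockOf_bpt bpt_bijective bpt_val bpt_eq_natCast)
open Summit.QuantumFields.BalabanUV.Beta.GAN24.DirichletBoxTrace (blockReg)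
open DirichletRingCutoff (tIdx)
open DirichletVertexChart

variable (n : ℕ) [NeZero n] (M : Fin 2 → ℕ) [hM : ∀ μ, NeZero (M μ)]

/-! ## §1 The identity orientation, location of a site, vertex shift, re-orientation -/

/-- the identity orientation (both coordinates increasing). [folklore] -/
def TT : Fin 2 → Bool := fun _ => true

omit [NeZero n] hM in
/-- `crd TT ν = id`. [folklore] -/
@[simp] theorem crd_TT (ν : Fin 2) (c : ℤ) : crd TT ν c = c := by simp [crd, TT]

omit [NeZero n] hM in
/-- `TT ν = true`. [folklore] -/
@[simp] theorem TT_apply (ν : Fin 2) : TT ν = true := rfl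

omit [NeZero n] in
/-- the identity-oriented chart is `up b` plus the model coordinates: `emb TT b i j = up b + (i, j)`. [folklore] -/
theorem emb_TT_eq (b : Tor M) (i j : ℤ) :
    emb n M TT b i j = up n M b + fun ν => ((cvec i j ν : ℤ) : ZMod (fine n M ν)) := by
  funext ν
  rw [Pi.add_apply, emb_apply, crd_TT]
  have hy : b ν = (((b ν).val : ℤ) : ZMod (M ν)) := by rw [Int.cast_natCast, ZMod.natCast_zmod_val]
  have hup : up n M b ν = (n : ZMod (fine n M ν)) * (((b ν).val : ℤ) : ZMod (fine n M ν)) := by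
    show upHom n M ν (b ν) = _
    conv_lhs => rw [hy]
    exact upHom_intCast n M ν _
  rw [hup]
  push_cast
  ring

/-- **EVERY SITE IS A CHART SITE OF ITS OWN BLOCK**: `x = emb TT (blockOf x) o₀ o₁` with the in-block offsets `o_ν = (x ν).val % n`. [folklore] -/
theorem emb_TT_blockOf (x : Tor (fine n M)) :
    emb n M TT (blockOf n M x) (((x 0).val % n : ℕ) : ℤ) (((x 1).val % n : ℕ) : ℤ) = x := by
  obtain ⟨⟨y, o⟩, hx⟩ := (bpt_bijective n M).2 x
  simp only at hx
  subst hx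
  rw [blockOf_bpt]
  have ho : ∀ ν, (bpt n M y o ν).val % n = o ν := by
    intro ν; rw [bpt_val, Nat.mul_add_mod, Nat.mod_eq_of_lt (o ν).is_lt]
  rw [ho 0, ho 1]
  funext ν
  rw [emb_apply, bpt_eq_natCast, crd_TT]
  have hc : cvec (((o 0 : ℕ) : ℕ) : ℤ) (((o 1 : ℕ) : ℕ) : ℤ) ν = ((o ν : ℕ) : ℤ) := by
    fin_cases ν <;> simp [cvec]
  rw [hc]
  push_cast
  ring

/-- the block coordinate is the integer quotient of the site coordinate: `(x ν).val / n = (blockOf x ν).val`. [folklore] -/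
theorem val_div_eq_blockOf (x : Tor (fine n M)) (ν : Fin 2) : (x ν).val / n = (blockOf n M x ν).val := by
  obtain ⟨⟨y, o⟩, hx⟩ := (bpt_bijective n M).2 x
  simp only at hx
  subst hx
  rw [blockOf_bpt, bpt_val, Nat.mul_add_div (Nat.pos_of_ne_zero (NeZero.ne n)), Nat.div_eq_of_lt (o ν).is_lt, add_zero]

omit [NeZero n] hM in
/-- shifting the `μ`-th model coordinate by `n`. [folklore] -/
theorem cvec_shift (μ ν : Fin 2) (i j : ℤ) :
    cvec (i + if μ = 0 then (n : ℤ) else 0) (j + if μ = 1 then (n : ℤ) else 0) ν = cvec i j ν + if ν = μ then (n : ℤ) else 0 := by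
  fin_cases μ <;> fin_cases ν <;> simp [cvec]

omit [NeZero n] in
/-- **VERTEX SHIFT**: moving the base vertex by `e_μ` shifts the `μ`-th model coordinate by `−n`:
`emb TT (b + e_μ) i j = emb TT b (i + n·[μ = 0]) (j + n·[μ = 1])`. [folklore] -/
theorem emb_TT_add_unitVec (μ : Fin 2) (b : Tor M) (i j : ℤ) :
    emb n M TT (b + unitVec M μ) i j
      = emb n M TT b (i + if μ = 0 then (n : ℤ) else 0) (j + if μ = 1 then (n : ℤ) else 0) := by
  rw [emb_TT_eq, emb_TT_eq, up_add, up_unitVec]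
  funext ν
  simp only [Pi.add_apply, tstep, cvec_shift]
  split_ifs <;> push_cast <;> ring

omit [NeZero n] hM in
/-- `crd` is an involution. [folklore] -/
theorem crd_crd (σ : Fin 2 → Bool) (ν : Fin 2) (c : ℤ) : crd σ ν (crd σ ν c) = c := by
  unfold crd; split_ifs <;> ring

omit [NeZero n] hM in
/-- the half-index is reflection-invariant. [folklore] -/
theorem tIdx_crd (σ : Fin 2 → Bool) (ν : Fin 2) (c : ℤ) : tIdx (crd σ ν c) = tIdx c := by
  unfold tIdx crd; split_ifs <;> omega

omit [NeZero n] hM in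
/-- the sign of a reflected coordinate: `0 ≤ crd σ ν c ↔ decide (0 ≤ c) = σ ν`. [folklore] -/
theorem crd_nonneg_iff (σ : Fin 2 → Bool) (ν : Fin 2) (c : ℤ) : 0 ≤ crd σ ν c ↔ decide (0 ≤ c) = σ ν := by
  unfold crd
  cases σ ν
  · simp only [Bool.false_eq_true, ↓reduceIte, decide_eq_false_iff_not, not_le]; omega
  · simp

omit [NeZero n] hM in
/-- **RE-ORIENTATION**: `emb σ b (crd σ 0 i) (crd σ 1 j) = emb TT b i j`. [folklore] -/
theorem emb_crd (σ : Fin 2 → Bool) (b : Tor M) (i j : ℤ) : emb n M σ b (crd σ 0 i) (crd σ 1 j) = emb n M TT b i j := by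
  funext ν
  rw [emb_apply, emb_apply, crd_TT]
  congr 2
  fin_cases ν
  · simp [cvec, crd_crd]
  · simp [cvec, crd_crd]

/-! ## §2 Star patterns in the identity orientation -/

omit hM in
/-- the identity-oriented star block of pattern `p`: `b_ν − [p ν = false]`. [folklore] -/
theorem starBlk_TT (b : Tor M) (p : Fin 2 → Bool) (ν : Fin 2) :
    starBlk M TT b p ν = b ν - (if p ν then 0 else 1) := by
  simp only [starBlk, TT_apply]
  rcases Bool.eq_false_or_eq_true (p ν) with h | h <;> simp [h]

omit hM in
/-- the star block of pattern `p` in orientation `σ` is the identity-oriented star block of `p ≡ σ`. [folklore] -/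
theorem starBlk_eq_TT (σ : Fin 2 → Bool) (b : Tor M) (p : Fin 2 → Bool) :
    starBlk M σ b p = starBlk M TT b (fun ν => p ν == σ ν) := by
  funext ν
  simp only [starBlk, TT_apply]
  rcases Bool.eq_false_or_eq_true (p ν) with h | h <;> rcases Bool.eq_false_or_eq_true (σ ν) with h' | h' <;> simp [h, h']

omit hM in
/-- a sign pattern is the vector of its two values. [folklore] -/
theorem pat_eq (p : Fin 2 → Bool) : p = ![p 0, p 1] := by
  funext ν; fin_cases ν <;> rfl

omit hM in
/-- quantifying over patterns = quantifying over two Booleans. [folklore] -/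
theorem forall_pat {Q : (Fin 2 → Bool) → Prop} : (∀ p, Q p) ↔ ∀ a y : Bool, Q ![a, y] :=
  ⟨fun h a y => h _, fun h p => by rw [pat_eq p]; exact h _ _⟩

omit hM in
/-- equality of two-vectors of Booleans. [folklore] -/
theorem vec2_eq_iff (a y c d : Bool) : (![a, y] : Fin 2 → Bool) = ![c, d] ↔ a = c ∧ y = d := by
  constructor
  · intro h
    exact ⟨by simpa using congrFun h 0, by simpa using congrFun h 1⟩
  · rintro ⟨rfl, rfl⟩; rfl

variable {S : Tor M → Prop}

omit hM in
/-- **RE-ENTRANT AT `σ` ⟺ the identity-oriented star misses exactly the pattern `σ`.** [folklore] -/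
theorem reentrantAt_iff_TT (σ : Fin 2 → Bool) (b : Tor M) :
    ReentrantAt M S σ b ↔ (¬ S (starBlk M TT b σ) ∧ ∀ p : Fin 2 → Bool, p ≠ σ → S (starBlk M TT b p)) := by
  have key : ∀ p : Fin 2 → Bool, starBlk M σ b p = starBlk M TT b (fun ν => p ν == σ ν) := starBlk_eq_TT M σ b
  have hσ : (fun ν => (fun _ : Fin 2 => true) ν == σ ν) = σ := by
    funext ν; show (true == σ ν) = σ ν; rcases Bool.eq_false_or_eq_true (σ ν) with h | h <;> simp [h]
  have inv : ∀ p : Fin 2 → Bool, (fun ν => (fun ν => p ν == σ ν) ν == σ ν) = p := by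
    intro p; funext ν; show ((p ν == σ ν) == σ ν) = p ν
    rcases Bool.eq_false_or_eq_true (p ν) with h | h <;> rcases Bool.eq_false_or_eq_true (σ ν) with h' | h' <;> simp [h, h']
  constructor
  · rintro ⟨h1, h2⟩
    refine ⟨by rw [key, hσ] at h1; exact h1, fun p hp => ?_⟩
    have h := h2 (fun ν => p ν == σ ν) (by
      intro hq; apply hp
      funext ν
      have h := congrFun hq ν
      simpa using h)
    rw [key, inv] at h
    exact h
  · rintro ⟨h1, h2⟩
    refine ⟨by rw [key, hσ]; exact h1, fun p hp => ?_⟩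
    rw [key]
    refine h2 _ fun hq => hp ?_
    funext ν
    have h := congrFun hq ν
    show p ν = true
    rcases Bool.eq_false_or_eq_true (p ν) with h' | h' <;> rcases Bool.eq_false_or_eq_true (σ ν) with h'' | h'' <;>
      simp [h', h''] at h ⊢

/-- the first-coordinate projection of the identity-oriented star pattern: `Arow s ↔ (s, T) ∈ P ∨ (s, F) ∈ P`. [folklore] -/
def Arow (S : Tor M → Prop) (b : Tor M) (s : Bool) : Prop := S (starBlk M TT b ![s, true]) ∨ S (starBlk M TT b ![s, false])

/-- the second-coordinate projection: `Bcol t ↔ (T, t) ∈ P ∨ (F, t) ∈ P`. [folklore] -/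
def Bcol (S : Tor M → Prop) (b : Tor M) (t : Bool) : Prop := S (starBlk M TT b ![true, t]) ∨ S (starBlk M TT b ![false, t])

/-- [shape] **PRODUCT STAR**: the star pattern of `b` is the product of its two projections. [folklore] -/
def IsProdAt (S : Tor M → Prop) (b : Tor M) : Prop :=
  ∀ p : Fin 2 → Bool, S (starBlk M TT b p) ↔ Arow M S b (p 0) ∧ Bcol M S b (p 1)

/-- decidability of the projections. [folklore] -/
instance decArow [DecidablePred S] (b : Tor M) : DecidablePred (Arow M S b) := fun s =>
  inferInstanceAs (Decidable (S (starBlk M TT b ![s, true]) ∨ S (starBlk M TT b ![s, false])))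

/-- decidability. [folklore] -/
instance decBcol [DecidablePred S] (b : Tor M) : DecidablePred (Bcol M S b) := fun t =>
  inferInstanceAs (Decidable (S (starBlk M TT b ![true, t]) ∨ S (starBlk M TT b ![false, t])))

/-- decidability of the product test (classical; used only to filter finite families of windows). [folklore] -/
instance decIsProdAt (S : Tor M → Prop) (b : Tor M) : Decidable (IsProdAt M S b) := Classical.dec _

/-- decidability of re-entrance (classical). [folklore] -/
instance decReentrantAt (S : Tor M → Prop) (σ : Fin 2 → Bool) (b : Tor M) : Decidable (ReentrantAt M S σ b) := Classical.dec _

omit hM in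
/-- **THE TRICHOTOMY** (the 16 patterns are 10 products, 4 re-entrant triples, 2 checkerboard diagonals): a block `(a, y)` of `S` in the
star of `b` whose star is NOT a product and which is NOT an isolated piece (one of its two axis-neighbours in the star is in `S`) lies at a
RE-ENTRANT vertex `(σ, b)` for some `σ`. [folklore] -/
theorem exists_reentrant (b : Tor M) {a y : Bool} (hay : S (starBlk M TT b ![a, y])) (hprod : ¬ IsProdAt M S b)
    (hiso : S (starBlk M TT b ![!a, y]) ∨ S (starBlk M TT b ![a, !y])) : ∃ σ : Fin 2 → Bool, ReentrantAt M S σ b := by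
  suffices h : ∃ c d : Bool, ¬ S (starBlk M TT b ![c, d]) ∧ ∀ a' y' : Bool, (![a', y'] : Fin 2 → Bool) ≠ ![c, d] →
      S (starBlk M TT b ![a', y']) by
    -- the four atoms generate every star block
    have hP : ∀ p : Fin 2 → Bool, S (starBlk M TT b p) ↔ S (starBlk M TT b ![p 0, p 1]) := fun p => by
      conv_lhs => rw [pat_eq p]
    obtain ⟨c, d, h1, h2⟩ := h
    exact ⟨![c, d], (reentrantAt_iff_TT M _ b).mpr ⟨h1, fun p hp => by rw [hP]; exact h2 _ _ (by rw [← pat_eq p]; exact hp)⟩⟩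
  simp only [IsProdAt, forall_pat, Arow, Bcol, Matrix.cons_val_zero, Matrix.cons_val_one] at hprod
  simp only [ne_eq, vec2_eq_iff, Bool.exists_bool, Bool.forall_bool, Bool.true_eq_false, Bool.false_eq_true, and_true, true_and,
    and_false, not_false_eq_true, not_true_eq_false, true_implies, false_implies] at hprod ⊢
  cases a <;> cases y <;> simp only [Bool.not_true, Bool.not_false] at hay hiso <;>
    by_cases h1 : S (starBlk M TT b ![true, true]) <;> by_cases h2 : S (starBlk M TT b ![true, false]) <;>
    by_cases h3 : S (starBlk M TT b ![false, true]) <;> by_cases h4 : S (starBlk M TT b ![false, false]) <;>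
    simp only [h1, h2, h3, h4] at hay hiso hprod ⊢ <;> tauto

/-! ## §3 Rounding in-block offsets to the grid `q·{0,…,4}` -/

/-- rounding to the nearest multiple of `q`: `rnd q o = ⌊(2o + q)/(2q)⌋`. [folklore] -/
def rnd (q o : ℕ) : ℕ := (2 * o + q) / (2 * q)

omit [NeZero n] hM in
/-- the defining inequalities of the rounding: `2q·rnd ≤ 2o + q < 2q·rnd + 2q`. [folklore] -/
theorem rnd_bounds {q : ℕ} (hq : 1 ≤ q) (o : ℕ) : rnd q o * (2 * q) ≤ 2 * o + q ∧ 2 * o + q < rnd q o * (2 * q) + 2 * q :=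
  ⟨Nat.div_mul_le_self _ _, Nat.lt_div_mul_add (by omega)⟩

omit [NeZero n] hM in
/-- the rounding error is at most `q/2`: `−q ≤ 2(o − q·rnd) < q`. [folklore] -/
theorem rnd_dist {q : ℕ} (hq : 1 ≤ q) (o : ℕ) :
    -(q : ℤ) ≤ 2 * ((o : ℤ) - q * rnd q o) ∧ 2 * ((o : ℤ) - q * rnd q o) < q := by
  obtain ⟨h1, h2⟩ := rnd_bounds hq o
  set k := rnd q o
  have h1' : ((k * (2 * q) : ℕ) : ℤ) ≤ ((2 * o + q : ℕ) : ℤ) := by exact_mod_cast h1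
  have h2' : ((2 * o + q : ℕ) : ℤ) < ((k * (2 * q) + 2 * q : ℕ) : ℤ) := by exact_mod_cast h2
  push_cast at h1' h2'
  constructor <;> nlinarith

omit [NeZero n] hM in
/-- on a block of side `n < 4q + 4` the rounded index is at most `4` (`q ≥ 5`). [folklore] -/
theorem rnd_le_four {q o : ℕ} (hq : 5 ≤ q) (ho : o < 4 * q + 3) : rnd q o ≤ 4 := by
  obtain ⟨h1, -⟩ := rnd_bounds (by omega : 1 ≤ q) o
  by_contra h
  have h5 : 5 * (2 * q) ≤ rnd q o * (2 * q) := Nat.mul_le_mul_right _ (by omega)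
  omega

omit [NeZero n] hM in
/-- the model coordinate after rounding to an interior grid point lies in the plateau: `2·tIdx (o − q·rnd) ≤ q + 2`. [folklore] -/
theorem tIdx_sub_rnd_le {q : ℕ} (hq : 1 ≤ q) (o : ℕ) : 2 * tIdx ((o : ℤ) - q * rnd q o) ≤ q + 2 := by
  obtain ⟨h1, h2⟩ := rnd_dist hq o
  unfold tIdx; split_ifs <;> omega

omit [NeZero n] hM in
/-- … and after rounding UP to the next vertex (`rnd = 4`, coordinate `o − n` relative to it): `2·tIdx (o − n) ≤ q + 6`
(`n < 4q + 4`, `o < n`). [folklore] -/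
theorem tIdx_sub_n_le {q o n' : ℕ} (hq : 1 ≤ q) (hn : n' < 4 * q + 4) (hn' : 4 * q ≤ n') (ho : o < n') (h4 : rnd q o = 4) :
    2 * tIdx ((o : ℤ) - n') ≤ q + 6 := by
  obtain ⟨h1, -⟩ := rnd_dist hq o
  rw [h4] at h1
  push_cast at h1
  unfold tIdx; split_ifs <;> omega

end Summit.QuantumFields.BalabanUV.Beta.GAN24.DirichletVertexLocate

end
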